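import Summits.Schanuel.Schanuel.Theses.RigidCore
import HarnessLib

/-!
# Vocabulary of line `cusp-germ-schneider-sparsity` for crux `RigidCore.SparsityTwo` (stmt-Schanuel-0971):
# the normalised cusp datum and the three atoms as named `Prop`s

Route `RigidCore` (sub-problem `Schanuel/Schanuel`), crux
`Summit.Schanuel.Schanuel.Theses.RigidCore.SparsityTwo` (a `ℚ`-defined `W ⊆ ℂ² × ℂ²` of `zariskiDim < 2` carries only
finitely many `ℚ`-linearly independent exponential points `(x, eˣ)`).  This is the **definitions module** of the line
lead's skeleton (idea card `Cruxes/SparsityTwo/Ideas/cusp-germ-schneider-sparsity.md`, line leads gen 0 – c3, `PICKED.md`):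
it carries, sorry-free, the ONE object all three residual atoms of the line quantify over — the normalised cusp datum
`CuspDatum` — and the three registered OPEN stub statements as named `Prop`s (`WildCuspAtom` = `stub_wildCuspAtom`,
`InhomogeneousCuspAtom` = `stub_inhomogeneousCuspAtom`, `LinearCuspAtom` = `stub_linearCuspAtom`, each the registered
statement with its 45 shared binders/hypotheses bundled into `CuspDatum`), so that the glue
`WildCuspAtom → InhomogeneousCuspAtom → LinearCuspAtom → SparsityTwo` and the equivalence `SparsityTwo ↔ …` are short
statements (`Theorems/RigidCoreSparsityTwoOfAtoms.lean`) — the pattern of `DiophantineDichotomyKhovanskiiApproxTypeEvDefs.lean`.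
Nothing here is asserted: every `def … : Prop` is a statement to be proved; the atoms are OPEN (each contains a
kernel-checked open exact-coincidence problem, `Cruxes/SparsityTwo/Disproof.lean` §3a–c) and each is implied by the crux
(`Theorems/RigidCoreSparsityTwoAtomsOfCrux.lean`), hence by SC(2).

## The object

Infinitely many independent exponential points of a `ℚ`-curve `W` accumulate at a place at infinity of `W`; after the
landed escape / classes / Runge / reality / lacunarity theorems (`RigidCoreSparsityTwo{CuspEscapeAlg, ClassicalClassesFinite,
SplitLemmas, NonRealJetFinite, CuspZeroLogDensity}`) what is left is ONE normalised log-free cusp RAY with its algebraic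
uniformisation, recorded by `CuspDatum`:
* σ-side (`σ = n^{-1/e}` on the positive ray; `w n = n^{1/e}` is `rayAbscissa e n`): ramification `e ≥ 1`, polar jet
  `A ∈ ℂ[w]` with REAL coefficients that is not `q(N) + c` (`q ∈ ℚ[X]`), tail `g` analytic at `0`, `g 0 = 0`, real on the
  ray, TRANSCENDENTAL over `ℂ(z)`, log germs `ℓu, ℓv`; the ray points are
  `x n = (2πi n + ℓu σ, 2πi (A(w n) + g σ) + ℓv σ)` with `e^{x n} = (e^{ℓu σ}, e^{ℓv σ})` iff `A(w n) + g(σ) ∈ ℤ` (a HIT);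
  the hits are lacunary (zero lower logarithmic density: Theorem S);
* t-side (algebraic uniformisation, `t = T σ`): `x = (t⁻ᵉ, Φ₁ t / t^{N₀})`, `y = (e^{ℓ₀ t}, e^{ℓ₁ t})`, linked to the σ-side
  by `link`; a `ℚ`-curve `W'` through the `t`-branch (`curve`), the six non-zero rational pair relations among the four
  coordinates (`rel_*`), and the arithmetic normal form: algebraic Taylor coefficients of `Φ₁` and of `ℓ₀, ℓ₁` in positive
  order, algebraic cusp values `e^{ℓⱼ 0}`.
Conclusion of every atom: `D.indepHits = {n | x n  ℚ-independent ∧ A(w n) + g(w n)⁻¹ ∈ ℤ}` is finite.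

## The atoms
* `WildCuspAtom` (A3): the `t`-jet of `x₂` is NOT `β t⁻ᵉ + G t` (ramified / non-linear ends; Disproof §3a root chain, §3b
  double-Cayley cubic), and `y` is not locally constant on the branch.
* `InhomogeneousCuspAtom` (A2): linear jet `x₂ = β x₁ + G(t)`, `β ∈ ℚ̄ ∖ ℚ`, `G` with algebraic Taylor data, `y` not locally
  constant, and the cusp is NOT torsion-homogeneous (a non-torsion cusp value, or both torsion and `G 0 ≠ 0`): exact hits
  `‖βM + γ + O(M^{-k/e})‖ = 0` with an inhomogeneous Baker period `γ`.
* `LinearCuspAtom` (A1): linear jet, torsion-homogeneous (`q ℓⱼ 0 = 2πi mⱼ`, `G 0 = 0`), `β` real algebraic irrational, and the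
  defect germ `Φ = β(ℓ₀ − ℓ₀ 0) − (ℓ₁ − ℓ₁ 0) + G` has order `j ≤ e`, `j < e (deg β − 1)`: exact hits at or below the
  Dirichlet scale (Disproof §3c: `β = ∛2`, `e = j = 1`).  The complementary depths are LANDED pockets: `j > e` Roth
  (`RigidCoreSparsityTwoRothCuspFinite`), `j ≥ e(deg β − 1)` Liouville / norm limit (`RigidCoreSparsityTwoDeepCuspFinite`).
-/

noncomputable section

-- `Summit.Schanuel.Schanuel.…` is the mandated summit/sub-problem namespace (single-conjunct summit), hence:
set_option linter.dupNamespace false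

namespace Summit.Schanuel.Schanuel.Cruxes.SparsityTwo.CuspGermSchneiderSparsity

open Filter Topology Complex Polynomial Literature.NumberTheory.Transcendental
open scoped Real

/-! ## Ray abscissae and the cusp datum -/

/-- The ray abscissa `w n = n^{1/e}` (real `e`-th root of `n`, coerced to `ℂ`); the uniformiser of the `n`-th ray point is
`σ = (w n)⁻¹ = n^{-1/e}`.  This is verbatim the `let w` of the registered stubs. -/
def rayAbscissa (e n : ℕ) : ℂ :=
  (((n : ℝ) ^ ((e : ℝ)⁻¹) : ℝ) : ℂ)

/-- **Normalised log-free cusp datum of a `ℚ`-curve** (the common 12 binders and 33 hypotheses of the three registered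
atoms `stub_wildCuspAtom`, `stub_inhomogeneousCuspAtom`, `stub_linearCuspAtom` of crux stmt-Schanuel-0971, in their order):
the σ-side ray `(e, A, g, ℓu, ℓv, ρ)` with transcendental real tail, non-`q(N)+c` real jet and lacunary hits; the algebraic
uniformisation `(N₀, T, ℓ₀, ℓ₁, Φ₁, r)` with the linking identities; a `ℚ`-curve through the `t`-branch; the six rational
pair relations; algebraic Taylor data.  Produced from an infinite `indepExpPoints W` by the landed
`stub_cuspEscapeAlg` / `stub_taylorLogCoeffsAlgebraic` / split (`Theorems/RigidCoreSparsityTwo{CuspEscapeAlg,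
TaylorLogCoeffsAlgebraic, Split}`). -/
structure CuspDatum where
  /-- ramification index of the polar coordinate at the cusp -/
  e : ℕ
  /-- pole order used to write the second additive coordinate as `Φ₁ t / t ^ N₀` -/
  N₀ : ℕ
  /-- polar jet of the hit function (a polynomial in `w n = n^{1/e}`) -/
  A : Polynomial ℂ
  /-- tail of the hit function (analytic at `0`, `g 0 = 0`) -/
  g : ℂ → ℂ
  /-- σ-side logarithm germ of `y₁` -/
  ℓu : ℂ → ℂ
  /-- σ-side logarithm germ of `y₂` -/
  ℓv : ℂ → ℂ
  /-- change of uniformiser `t = T σ` -/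
  T : ℂ → ℂ
  /-- t-side logarithm germ of `y₁` -/
  ℓ₀ : ℂ → ℂ
  /-- t-side logarithm germ of `y₂` -/
  ℓ₁ : ℂ → ℂ
  /-- numerator germ of the second additive coordinate `x₂ = Φ₁ t / t ^ N₀` -/
  Φ₁ : ℂ → ℂ
  /-- radius of the σ-disc -/
  ρ : ℝ
  /-- radius of the t-disc -/
  r : ℝ
  e_pos : 0 < e
  ρ_pos : 0 < ρ
  r_pos : 0 < r
  g_analytic : AnalyticAt ℂ g 0
  g_zero : g 0 = 0
  ℓu_analytic : AnalyticAt ℂ ℓu 0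
  ℓv_analytic : AnalyticAt ℂ ℓv 0
  T_analytic : AnalyticAt ℂ T 0
  T_zero : T 0 = 0
  ℓ₀_analytic : AnalyticAt ℂ ℓ₀ 0
  ℓ₁_analytic : AnalyticAt ℂ ℓ₁ 0
  Φ₁_analytic : AnalyticAt ℂ Φ₁ 0
  /-- the tail is transcendental over `ℂ(z)` -/
  transcendental : ¬ ∃ P : MvPolynomial (Fin 2) ℂ, P ≠ 0 ∧
    ∀ᶠ z in 𝓝 (0 : ℂ), MvPolynomial.eval ![z, g z] P = 0
  /-- the jet is not a rational polynomial in `N` plus a constant (that case is Runge: `RigidCoreSparsityTwoSplitLemmas`) -/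
  jet_not_rat : ¬ ∃ (q : Polynomial ℚ) (c : ℂ), ∀ N : ℕ,
    A.eval (rayAbscissa e N) = (q.map (algebraMap ℚ ℂ)).eval (N : ℂ) + c
  /-- jet and tail are real on the ray (the non-real case is `RigidCoreSparsityTwoNonRealJetFinite`) -/
  real : (∀ k : ℕ, (A.coeff k).im = 0) ∧ ∀ᶠ u : ℝ in 𝓝[>] 0, (g (u : ℂ)).im = 0
  /-- the hits have zero lower logarithmic density (Theorem S, `RigidCoreSparsityTwoCuspZeroLogDensity`) -/
  lacunary : ∀ ε : ℝ, 0 < ε → ∃ᶠ X : ℕ in atTop,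
    (Nat.card {N : ℕ | N ≤ X ∧ ∃ L : ℤ, A.eval (rayAbscissa e N) + g (rayAbscissa e N)⁻¹ = L} : ℝ) ≤ ε * Real.log X
  /-- the linking identities between the σ-side and the t-side (`t = T σ`) -/
  link : ∀ σ : ℂ, 0 < ‖σ‖ → ‖σ‖ < ρ → 0 < ‖T σ‖ ∧ ‖T σ‖ < r ∧
    ((T σ) ^ e)⁻¹ = 2 * ↑π * I * σ⁻¹ ^ e + ℓu σ ∧
    Φ₁ (T σ) / (T σ) ^ N₀ = 2 * ↑π * I * (A.eval σ⁻¹ + g σ) + ℓv σ ∧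
    ℓ₀ (T σ) = ℓu σ ∧ ℓ₁ (T σ) = ℓv σ
  /-- a `ℚ`-curve through the `t`-branch (this is what makes each atom an instance of the crux, hence SC(2)-implied) -/
  curve : ∃ W' : Set (Fin 2 ⊕ Fin 2 → ℂ), IsDefinedOver (⊥ : Subfield ℂ) W' ∧ zariskiDim ℂ W' < 2 ∧
    ∀ t : ℂ, 0 < ‖t‖ → ‖t‖ < r →
      Sum.elim (![(t ^ e)⁻¹, Φ₁ t / t ^ N₀] : Fin 2 → ℂ)
        (![Complex.exp (ℓ₀ t), Complex.exp (ℓ₁ t)] : Fin 2 → ℂ) ∈ W'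
  rel_x₁_y₁ : ∃ R : MvPolynomial (Fin 2) ℚ, R ≠ 0 ∧ ∀ t : ℂ, 0 < ‖t‖ → ‖t‖ < r →
    MvPolynomial.aeval ![(t ^ e)⁻¹, Complex.exp (ℓ₀ t)] R = 0
  rel_x₁_y₂ : ∃ R : MvPolynomial (Fin 2) ℚ, R ≠ 0 ∧ ∀ t : ℂ, 0 < ‖t‖ → ‖t‖ < r →
    MvPolynomial.aeval ![(t ^ e)⁻¹, Complex.exp (ℓ₁ t)] R = 0
  rel_x₁_x₂ : ∃ R : MvPolynomial (Fin 2) ℚ, R ≠ 0 ∧ ∀ t : ℂ, 0 < ‖t‖ → ‖t‖ < r →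
    MvPolynomial.aeval ![(t ^ e)⁻¹, Φ₁ t / t ^ N₀] R = 0
  rel_x₂_y₁ : ∃ R : MvPolynomial (Fin 2) ℚ, R ≠ 0 ∧ ∀ t : ℂ, 0 < ‖t‖ → ‖t‖ < r →
    MvPolynomial.aeval ![Φ₁ t / t ^ N₀, Complex.exp (ℓ₀ t)] R = 0
  rel_x₂_y₂ : ∃ R : MvPolynomial (Fin 2) ℚ, R ≠ 0 ∧ ∀ t : ℂ, 0 < ‖t‖ → ‖t‖ < r →
    MvPolynomial.aeval ![Φ₁ t / t ^ N₀, Complex.exp (ℓ₁ t)] R = 0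
  rel_y₁_y₂ : ∃ R : MvPolynomial (Fin 2) ℚ, R ≠ 0 ∧ ∀ t : ℂ, 0 < ‖t‖ → ‖t‖ < r →
    MvPolynomial.aeval ![Complex.exp (ℓ₀ t), Complex.exp (ℓ₁ t)] R = 0
  Φ₁_algebraic : ∀ n : ℕ, IsAlgebraic ℚ (iteratedDeriv n Φ₁ 0)
  exp_ℓ₀_algebraic : IsAlgebraic ℚ (Complex.exp (ℓ₀ 0))
  exp_ℓ₁_algebraic : IsAlgebraic ℚ (Complex.exp (ℓ₁ 0))
  ℓ₀_algebraic : ∀ n : ℕ, 0 < n → IsAlgebraic ℚ (iteratedDeriv n ℓ₀ 0)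
  ℓ₁_algebraic : ∀ n : ℕ, 0 < n → IsAlgebraic ℚ (iteratedDeriv n ℓ₁ 0)

namespace CuspDatum

/-- The `n`-th ray point `x n = (2πi n + ℓu σ, 2πi (A (w n) + g σ) + ℓv σ)`, `σ = (w n)⁻¹` (verbatim the `let x` of the
registered stubs). -/
def x (D : CuspDatum) (n : ℕ) : Fin 2 → ℂ :=
  ![2 * ↑π * I * (n : ℂ) + D.ℓu (rayAbscissa D.e n)⁻¹,
    2 * ↑π * I * (D.A.eval (rayAbscissa D.e n) + D.g (rayAbscissa D.e n)⁻¹) + D.ℓv (rayAbscissa D.e n)⁻¹]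

/-- The INDEPENDENT HITS of the datum: ray points `n` with `x n` `ℚ`-linearly independent at which the hit function
`A (w n) + g (w n)⁻¹` takes an integer value (equivalently `e^{x n} = (e^{ℓu σ}, e^{ℓv σ})`).  Every atom concludes that
this set is finite. -/
def indepHits (D : CuspDatum) : Set ℕ :=
  {n : ℕ | LinearIndependent ℚ (D.x n) ∧ ∃ L : ℤ, D.A.eval (rayAbscissa D.e n) + D.g (rayAbscissa D.e n)⁻¹ = L}

/-- The datum has a LINEAR `t`-JET with slope `β` and regular part `G`: `x₂ = β x₁ + G t` on the punctured `t`-disc. -/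
def IsLinearJet (D : CuspDatum) (β : ℂ) (G : ℂ → ℂ) : Prop :=
  ∀ t : ℂ, 0 < ‖t‖ → ‖t‖ < D.r → D.Φ₁ t / t ^ D.N₀ = β * (t ^ D.e)⁻¹ + G t

/-- The exponential coordinates are LOCALLY CONSTANT on the branch (the constant-`y` case is the landed mixed-period
pocket `RigidCoreSparsityTwoMixedPeriodPocket`; every atom assumes its negation). -/
def IsLocallyConstantExp (D : CuspDatum) : Prop :=
  ∀ᶠ t in 𝓝 (0 : ℂ), D.ℓ₀ t = D.ℓ₀ 0 ∧ D.ℓ₁ t = D.ℓ₁ 0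

/-- The DEFECT GERM of a linear cusp of slope `β` with regular part `G`:
`Φ = β (ℓ₀ − ℓ₀ 0) − (ℓ₁ − ℓ₁ 0) + G`; at a torsion-homogeneous cusp the hits are `β(qn + m₀) + q Φ(t n)/(2πi) ∈ ℤ`. -/
def defectGerm (D : CuspDatum) (β : ℂ) (G : ℂ → ℂ) : ℂ → ℂ :=
  fun t => β * (D.ℓ₀ t - D.ℓ₀ 0) - (D.ℓ₁ t - D.ℓ₁ 0) + G t

end CuspDatum

/-! ## The three atoms (registered OPEN stubs of crux stmt-Schanuel-0971, as named statements) -/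

/-- **Atom A3 — wild jet** (registered stub `stub_wildCuspAtom`; OPEN; Disproof §3a root chain, §3b double-Cayley cubic).
For every normalised cusp datum whose `t`-jet of the second additive coordinate is NOT linear (`Φ₁ t / t^{N₀} ≠ β t⁻ᵉ + G t`
for all `β`, analytic `G`) and whose exponential coordinates are not locally constant, the independent hits are finite. -/
def WildCuspAtom : Prop :=
  ∀ D : CuspDatum,
    (¬ ∃ (β : ℂ) (G : ℂ → ℂ), AnalyticAt ℂ G 0 ∧ D.IsLinearJet β G) →
    ¬ D.IsLocallyConstantExp →
    D.indepHits.Finite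

/-- **Atom A2 — inhomogeneous linear cusp** (registered stub `stub_inhomogeneousCuspAtom`; OPEN; non-torsion phases /
non-zero algebraic constant).  Linear jet `x₂ = β x₁ + G t` with `β` algebraic irrational and `G` analytic with algebraic
Taylor coefficients, exponential coordinates not locally constant, and the cusp NOT torsion-homogeneous (if both cusp values
`e^{ℓⱼ 0}` are roots of unity then `G 0 ≠ 0`): the independent hits are finite.  Exact hits
`‖βM + γ + O(M^{-k/e})‖ = 0` with an inhomogeneous constant `γ` carrying a Baker period. -/
def InhomogeneousCuspAtom : Prop :=
  ∀ (D : CuspDatum) (G : ℂ → ℂ) (β : ℂ),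
    AnalyticAt ℂ G 0 → D.IsLinearJet β G →
    IsAlgebraic ℚ β → (∀ n : ℕ, IsAlgebraic ℚ (iteratedDeriv n G 0)) →
    (∀ r' : ℚ, (r' : ℂ) ≠ β) →
    ¬ D.IsLocallyConstantExp →
    ((∃ q : ℕ, 0 < q ∧ Complex.exp (D.ℓ₀ 0) ^ q = 1 ∧ Complex.exp (D.ℓ₁ 0) ^ q = 1) → G 0 ≠ 0) →
    D.indepHits.Finite

/-- **Atom A1 — torsion-homogeneous linear cusp at or below the Dirichlet scale** (registered stub `stub_linearCuspAtom`;
OPEN; Disproof §3c slope `∛2`).  Linear jet with `β` REAL algebraic irrational, `G` with algebraic Taylor data, torsion cusp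
values `q ℓⱼ 0 = 2πi mⱼ`, `G 0 = 0`, exponential coordinates not locally constant, and the defect germ
`Φ = β(ℓ₀ − ℓ₀ 0) − (ℓ₁ − ℓ₁ 0) + G` of order exactly `j` with `j ≤ e` and `j < e (deg_ℚ β − 1)`: the independent hits are
finite.  (Depths `j > e` and `j ≥ e (deg β − 1)` are the landed Roth and deep pockets.) -/
def LinearCuspAtom : Prop :=
  ∀ (D : CuspDatum) (G : ℂ → ℂ) (β : ℂ) (q : ℕ) (m₀ m₁ : ℤ),
    AnalyticAt ℂ G 0 → D.IsLinearJet β G →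
    IsAlgebraic ℚ β → (∀ n : ℕ, IsAlgebraic ℚ (iteratedDeriv n G 0)) →
    (∀ r' : ℚ, (r' : ℂ) ≠ β) →
    β.im = 0 → 0 < q → (q : ℂ) * D.ℓ₀ 0 = 2 * ↑π * I * (m₀ : ℂ) → (q : ℂ) * D.ℓ₁ 0 = 2 * ↑π * I * (m₁ : ℂ) →
    G 0 = 0 →
    ¬ D.IsLocallyConstantExp →
    (∃ j : ℕ, j ≤ D.e ∧ j < D.e * ((minpoly ℚ β).natDegree - 1) ∧
      (∀ i : ℕ, i < j → iteratedDeriv i (D.defectGerm β G) 0 = 0) ∧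
      iteratedDeriv j (D.defectGerm β G) 0 ≠ 0) →
    D.indepHits.Finite

/-- Bookkeeping (`Iff.rfl`; the module's registered anchor on stmt-Schanuel-0971): membership in the independent hits. -/
theorem mem_indepHits : ∀ (D : CuspDatum) (n : ℕ), n ∈ D.indepHits ↔ LinearIndependent ℚ (D.x n) ∧ ∃ L : ℤ, D.A.eval (rayAbscissa D.e n) + D.g (rayAbscissa D.e n)⁻¹ = L :=
  fun _ _ => Iff.rfl

/-! ## Appended (lead c3, 2026-08-16): the inhomogeneous atom at BAKER-BOUNDED depth

The Baker depth cap of the linear cusp is LANDED (`Theorems/RigidCoreSparsityTwoBakerDepthCap.lean`,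
`linearCusp_bakerDepthCap`, over the pocket `stub_bakerDepthCapRay` and the tree's proved Baker Thm 3.1
`baker1975_thm_3_1_holds`): for every linear cusp datum there is `K` such that flatness of the defect germ to order `K`
already forces finiteness.  So the open content of A2 is the SHALLOW residual below; `RigidCoreSparsityTwoShallow.lean`
proves `InhomogeneousCuspAtom ↔ InhomogeneousCuspAtomShallow`. -/

/-- **Atom A2 at Baker-bounded depth** (the open residual of `InhomogeneousCuspAtom`; registered stub
`stub_inhomogeneousCuspAtomShallow`).  The data of `InhomogeneousCuspAtom` together with a depth cap `K` of the datum —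
`(∀ 1 ≤ j ≤ K, Φ⁽ʲ⁾(0) = 0) → D.indepHits.Finite`, as supplied by `linearCusp_bakerDepthCap` — and the shallowness it
leaves, `∃ 1 ≤ j ≤ K, Φ⁽ʲ⁾(0) ≠ 0` (`Φ = D.defectGerm β G`): the independent hits are finite.  Exact inhomogeneous hits
`‖βM + γ + O(M^{-j/e})‖ = 0` at depth `j ≤ K_Baker`, `γ` a Baker period.  OPEN; SC(2)-implied. -/
def InhomogeneousCuspAtomShallow : Prop :=
  ∀ (D : CuspDatum) (G : ℂ → ℂ) (β : ℂ) (K : ℕ),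
    AnalyticAt ℂ G 0 → D.IsLinearJet β G →
    IsAlgebraic ℚ β → (∀ n : ℕ, IsAlgebraic ℚ (iteratedDeriv n G 0)) →
    (∀ r' : ℚ, (r' : ℂ) ≠ β) →
    ¬ D.IsLocallyConstantExp →
    ((∃ q : ℕ, 0 < q ∧ Complex.exp (D.ℓ₀ 0) ^ q = 1 ∧ Complex.exp (D.ℓ₁ 0) ^ q = 1) → G 0 ≠ 0) →
    ((∀ j : ℕ, 1 ≤ j → j ≤ K → iteratedDeriv j (D.defectGerm β G) 0 = 0) → D.indepHits.Finite) →
    (∃ j : ℕ, 1 ≤ j ∧ j ≤ K ∧ iteratedDeriv j (D.defectGerm β G) 0 ≠ 0) →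
    D.indepHits.Finite

/-- Bookkeeping (registered anchor `inhomogeneousCuspAtomShallow_of_atom`): the shallow residual is implied by the atom
(ignore the depth data). -/
theorem inhomogeneousCuspAtomShallow_of_atom : InhomogeneousCuspAtom → InhomogeneousCuspAtomShallow :=
  fun h D G β _K hG hlin hβ hGalg hirr hnc htor _hcap _hshallow => h D G β hG hlin hβ hGalg hirr hnc htor

/-! ## Appended (lead c4, 2026-08-16): the wild atom BELOW EVERY π-CAP

The c4 pockets cap the depth of a wild cusp whose σ-jet has RATIONAL π-STRUCTURE, by the Nesterenko–Waldschmidt 1996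
transcendence measure of `π` (`NesterenkoWaldschmidt1996_thm_2_2_holds`, PROVED in the tree): for a π-MONOMIAL jet
`q (2π)^{j/e} w^m + q₀` (`Theorems/RigidCoreSparsityTwoWildPiMonomialDepthCapRay.lean`, p125323 — the sub-linear /
pure-power torsion class of Disproof §3a) and for a jet in `ℚ[π, π⁻¹][n]` genuinely involving `π`
(`Theorems/RigidCoreSparsityTwoWildPiPolynomialDepthCapRay.lean`, p125073 — the `e = 1` torsion class of Disproof §3b)
there is `K` (depending on the jet class only) such that flatness of the tail `g` to order `K` forces finiteness.  So the
open content of A3 is the SHALLOW residual below: `Theorems/RigidCoreSparsityTwoWildDepthCap.lean` proves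
`WildCuspAtom ↔ WildCuspAtomShallow` (the caps in `CuspDatum` form make the extra hypotheses inhabited). -/

/-- **Atom A3 below every π-cap** (the open residual of `WildCuspAtom`; registered stub `stub_wildCuspAtomShallow`, lead c4).
The data of `WildCuspAtom`, and in addition: for every π-MONOMIAL presentation `D.A = C (q (2π)^{j/e}) X^m + C q₀`
(`m ≥ 1`, `q ≠ 0`, `j ≠ 0`) of the σ-jet together with a depth cap `K` valid throughout that jet class (flatness of the
tail to order `K` forces finiteness for every datum of the class with the same `e`) the tail is `K`-SHALLOW
(`∃ i ≤ K, g⁽ⁱ⁾(0) ≠ 0`), and likewise for every presentation of the jet as an element of `ℚ[π, π⁻¹][n]` genuinely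
involving `π` (`∑_{m ≤ N} ∑_{|i| ≤ M} c m i · π^i · n^m`, some `c m i ≠ 0` with `i ≠ 0`).  Valid caps exist
(`wildCusp_piMonomial_depthCap`, `wildCusp_piPolynomial_depthCap`), so the deep rational-π-structure data are no longer
in the atom; left are the shallow ones (Disproof §3a/§3b themselves: depth `1`) and every wild datum without rational
π-structure (algebraic non-rational Puiseux data; non-torsion cusp values).  OPEN; SC(2)-implied. -/
def WildCuspAtomShallow : Prop :=
  ∀ D : CuspDatum,
    (¬ ∃ (β : ℂ) (G : ℂ → ℂ), AnalyticAt ℂ G 0 ∧ D.IsLinearJet β G) →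
    ¬ D.IsLocallyConstantExp →
    (∀ (m : ℕ) (j : ℤ) (q q₀ : ℚ) (K : ℕ), 0 < m → q ≠ 0 → j ≠ 0 →
      D.A = Polynomial.C ((q : ℂ) * (((2 * Real.pi) ^ ((j : ℝ) / (D.e : ℝ)) : ℝ) : ℂ)) * Polynomial.X ^ m
              + Polynomial.C (q₀ : ℂ) →
      (∀ D' : CuspDatum, D'.e = D.e →
        D'.A = Polynomial.C ((q : ℂ) * (((2 * Real.pi) ^ ((j : ℝ) / (D.e : ℝ)) : ℝ) : ℂ)) * Polynomial.X ^ m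
                + Polynomial.C (q₀ : ℂ) →
        (∀ i : ℕ, i ≤ K → iteratedDeriv i D'.g 0 = 0) → D'.indepHits.Finite) →
      ∃ i : ℕ, i ≤ K ∧ iteratedDeriv i D.g 0 ≠ 0) →
    (∀ (M N : ℕ) (c : ℕ → ℤ → ℚ) (K : ℕ),
      (∃ m : ℕ, ∃ i : ℤ, m ≤ N ∧ i ≠ 0 ∧ -(M : ℤ) ≤ i ∧ i ≤ M ∧ c m i ≠ 0) →
      (∀ n : ℕ, D.A.eval (rayAbscissa D.e n) =
        ∑ m ∈ Finset.range (N + 1), ∑ i ∈ Finset.Icc (-(M : ℤ)) M,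
          (c m i : ℂ) * (Real.pi : ℂ) ^ i * (n : ℂ) ^ m) →
      (∀ D' : CuspDatum, D'.e = D.e →
        (∀ n : ℕ, D'.A.eval (rayAbscissa D'.e n) =
          ∑ m ∈ Finset.range (N + 1), ∑ i ∈ Finset.Icc (-(M : ℤ)) M,
            (c m i : ℂ) * (Real.pi : ℂ) ^ i * (n : ℂ) ^ m) →
        (∀ i : ℕ, i ≤ K → iteratedDeriv i D'.g 0 = 0) → D'.indepHits.Finite) →
      ∃ i : ℕ, i ≤ K ∧ iteratedDeriv i D.g 0 ≠ 0) →
    D.indepHits.Finite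

/-- Bookkeeping (registered anchor `wildCuspAtomShallow_of_atom`): the shallow residual is implied by the atom (ignore
the cap data). -/
theorem wildCuspAtomShallow_of_atom : WildCuspAtom → WildCuspAtomShallow :=
  fun h D hnl hnc _hmono _hpoly => h D hnl hnc

end Summit.Schanuel.Schanuel.Cruxes.SparsityTwo.CuspGermSchneiderSparsity

end
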